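import Summits.CriticalPhenomena.CardyFormulaZ2.Theses.CardyUniqueLimit
import Summits.CriticalPhenomena.CardyFormulaZ2.Theorems.CardyUniqueLimitCardyRigidityDefs
import Summits.CriticalPhenomena.CardyFormulaZ2.Theorems.CardyUniqueLimitCardyRigidityStubKernelFacts
import Summits.CriticalPhenomena.CardyFormulaZ2.Theorems.CardyUniqueLimitCardyRigidityMvpRigidity
import Summits.CriticalPhenomena.CardyFormulaZ2.Theorems.CardyUniqueLimitCardyRigidityFarFieldEta
import Summits.CriticalPhenomena.CardyFormulaZ2.Theorems.CardyUniqueLimitCardyRigidityFarFieldEtaExpansion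
import HarnessLib

/-!
# `exit_hull_farfield` — f-FREE RESPLIT `GermCatalogue / EtaExpansion / GermMoments / MvpReadout`
# (crux `CardyRigidity`, stmt-CriticalPhenomena-0746; strategist s1, 2026-08-17)

NOT a new line.  This file re-cuts the alternative line `Lines/exit_hull_farfield.lean` (stubs P/S/N;
same seat) — ONE ball-exit stopping time ("germ") + far marks + hydrodynamic far-field expansion + the
LANDED rigidity theorem `Mvp.affineCardy_of_mvpData` — so that the percolation heart is a statement
WITHOUT the kernel `f` and WITHOUT the all-rectangle hypothesis:

* `GermCatalogue` (STUB G1, the heart): for every resolution `ε` a FINITE catalogue of fixed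
  piecewise-smooth conformal rectangles (reference domain minus a rounded pixel hull, tip mark, far
  marks) with hydrodynamic data and MARK-INDEPENDENT cell weights `π δ j`, an hcap floor, and the
  comparison `|P_δ(R₀ L a b c) - ∑ⱼ π δ j · P_δ(Rc j L a b c)| ≤ ε` eventually in `δ`, uniformly in the
  marks.  Intended proof of the comparison: exact domain Markov at the exit step, and
  `E_slit Δ E⁺ ⊆` six alternating arms near the germ ∪ half-plane three arms at the flat boundary ∪
  four arms at the tip (Camia–Newman 2007, proof of Lemma 6.1: "six disjoint crossings … probability
  `(ε'/ε)^{2+α}` … anywhere in D goes to zero"), i.e. static two-scale arm bounds — no sandwich /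
  monotonicity in the domain, no continuity of the unknown `f`, no crossing limits of rough slits.
* `EtaExpansion` (G2, deterministic), `GermMoments f` (G3: HYP on the finitely many catalogue
  rectangles per stage + finite-dimensional limits give an EXACT mean-value law with expanded moments),
  `MvpData f` (G4: normalisation `E hcap = 2`, scales `L_n = n/s`).

The published card of `exit_hull_farfield` asks that a resplit of its STUB P be "cut over the
exploration vocabulary"; this cut goes one step further: HYP is consumed only in G3 and only on
countably many FIXED honest `ConformalRectangle`s, and G1 is refutable / numerically testable on its
own (its quantifier order — `h₀`, `L₀` chosen before `ε` — is what excludes one-bump or symmetric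
two-bump pseudo-catalogues).  Composition `CardyRigidity_of` (sorry-free) concludes
`Summit.CriticalPhenomena.CardyFormulaZ2.Theses.CardyUniqueLimit.CardyRigidity` BY NAME; the only
`sorry`s are the four `stub_*`.  Like its parent, this file is published with `ledger crux write` and
deliberately NOT registered with `ledger skeleton check` while the lead's skeleton
(`crossing_martingale`, stubs `stub_percBoxTight` / `stub_percFaceAnnulusTransfer` /
`stub_slitObservableApprox`) is live: the registry holds one skeleton per crux.

Sources: Smirnov 2001 (C. R. Acad. Sci. 333) §2 and the long version arXiv:0909.4499 §3.2 (ε-step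
locality); Camia–Newman 2007 (PTRF 139) §5–7, Lemma 6.1; Kesten–Sidoravicius–Zhang 1998 Lemma 5 /
Nolin 2008 §5.2 (five-arm exponent `2`, also on bond `ℤ²`); Lawler–Schramm–Werner 2001 §3 (hcap
expansions); Lawler 2005 Prop. 3.46; Manfredi–Parviainen–Rossi 2010 (asymptotic mean value property).
-/

noncomputable section

open MeasureTheory Filter Set Topology
open scoped BigOperators
open UpperHalfPlane (upperHalfPlaneSet)
open Literature.Probability.RandomPlanarGeometry
open Literature.Probability.Percolation (bondDomainCrossingProb)
open Summit.CriticalPhenomena.CardyFormulaZ2.Cruxes.CardyRigidity.CrossingMartingale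

namespace Summit.CriticalPhenomena.CardyFormulaZ2.Cruxes.CardyRigidity.ExitHullFarField.GermCatalogueSplit

/-! ### §0 Vocabulary of the line (local predicates; real-variable interfaces between the stubs) -/

/-- **The germ catalogue** (output of the percolation heart; no kernel `f` occurs).  There are a
base family of conformal rectangles `R₀ L a b c` (one reference Jordan domain, exploration mark `p₀`
with half-plane preimage `0`, far marks with preimages `L a < L b < L c`), a threshold `L₀ a b c`, a
bound `C` and an hcap floor `h₀ > 0` such that for every resolution `ε > 0` there is a FINITE
catalogue `j < N` of hulls given through their hydrodynamic data — tip image `W j`, half-plane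
capacity `h j`, mapping-out function `g j` on the far axis with `|g j y - y - h j / y| ≤ C / y²`
(`y ≥ 3`) — realised by conformal rectangles `Rc j L a b c` (reference domain minus the hull, marks
`tip, far marks`) with uniformizing data `(W j, g j (L a), g j (L b), g j (L c))`, and cell weights
`π δ j` INDEPENDENT OF THE MARKS forming a probability vector with `∑ π δ j * h j ≥ h₀`, such that the
mesh-`δ` crossing probability of `R₀ L a b c` is within `ε` of `∑ j, π δ j * P_δ(Rc j L a b c)` for
all small `δ`.  (Intended witness: `π δ j` = probability that the exploration germ stopped at its
first exit of the unit ball lies in catalogue cell `j`; comparison = domain Markov + six-arm /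
boundary three-arm / tip bounds.)  [cite: CamiaNewman2007, §5–7] [cite: Smirnov2001, §2] -/
def GermCatalogue : Prop :=
  ∃ (R₀ : ℝ → ℝ → ℝ → ℝ → ConformalRectangle) (L₀ : ℝ → ℝ → ℝ → ℝ) (C h₀ : ℝ), 0 < h₀ ∧
    (∀ a b c : ℝ, 0 < a → a < b → b < c → ∀ L : ℝ, L₀ a b c ≤ L →
      ∃ φ : ConformalEquiv upperHalfPlaneSet (R₀ L a b c).carrier,
        (R₀ L a b c).IsUniformizing φ ![0, L * a, L * b, L * c]) ∧
    ∀ ε : ℝ, 0 < ε →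
      ∃ (N : ℕ) (W h : Fin N → ℝ) (g : Fin N → ℝ → ℝ)
        (Rc : Fin N → ℝ → ℝ → ℝ → ℝ → ConformalRectangle) (π : ℝ → Fin N → ℝ),
        (∀ j, |W j| ≤ C ∧ 0 ≤ h j ∧ h j ≤ C ∧
          ∀ y : ℝ, 3 ≤ y → |g j y - y - h j / y| ≤ C / y ^ 2) ∧
        (∀ᶠ δ in 𝓝[>] (0 : ℝ), (∀ j, 0 ≤ π δ j) ∧ ∑ j, π δ j = 1 ∧ h₀ ≤ ∑ j, π δ j * h j) ∧
        ∀ a b c : ℝ, 0 < a → a < b → b < c → ∀ L : ℝ, L₀ a b c ≤ L →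
          (∀ j, ∃ φ : ConformalEquiv upperHalfPlaneSet (Rc j L a b c).carrier,
            (Rc j L a b c).IsUniformizing φ ![W j, g j (L * a), g j (L * b), g j (L * c)]) ∧
          ∀ᶠ δ in 𝓝[>] (0 : ℝ),
            |bondDomainCrossingProb (R₀ L a b c) δ -
                ∑ j, π δ j * bondDomainCrossingProb (Rc j L a b c) δ| ≤ ε

/-- **The germ expansion of the modulus** (deterministic).  For hydrodynamically normalised data
`|W| ≤ C`, `0 ≤ h ≤ C`, `|g y - y - h / y| ≤ C / y²` (`y ≥ 3`) and far marks `L·(a,b,c)`, the modulus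
`η_L = crossRatio (W, g(La), g(Lb), g(Lc))` satisfies, with `S₁ = (c-b)(b-a)/((c-a)b²)`,
`η_L - η̂ = -S₁ W / L + (S₁ (a⁻¹+b⁻¹+c⁻¹) h - (S₁/b) W²) / L² + O(L⁻³)`,
`(η_L - η̂)² = S₁² W² / L² + O(L⁻³)`, `|η_L - η̂| = O(L⁻¹)`, uniformly in the data
(`crossRatio_eq_cardyEta`, `cardyEta_mul`, `farField_abs_cardyEta_sub_remainder_le`,
`farField_hasDerivAt_cardyEta_drift`).  [cite: LawlerSchrammWerner2001, §3] -/
def EtaExpansion : Prop :=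
  ∀ C : ℝ, 0 ≤ C → ∀ a b c : ℝ, 0 < a → a < b → b < c →
    ∃ C' L₀ : ℝ, 0 < L₀ ∧ ∀ L : ℝ, L₀ ≤ L → ∀ (W h : ℝ) (g : ℝ → ℝ),
      |W| ≤ C → 0 ≤ h → h ≤ C → (∀ y : ℝ, 3 ≤ y → |g y - y - h / y| ≤ C / y ^ 2) →
        |crossRatio ![W, g (L * a), g (L * b), g (L * c)] - cardyEta a b c -
            (-((c - b) * (b - a) / ((c - a) * b ^ 2) * W / L) +
              ((c - b) * (b - a) / ((c - a) * b ^ 2) * (a⁻¹ + b⁻¹ + c⁻¹) * h -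
                (c - b) * (b - a) / ((c - a) * b ^ 2) / b * W ^ 2) / L ^ 2)| ≤ C' / L ^ 3 ∧
        |(crossRatio ![W, g (L * a), g (L * b), g (L * c)] - cardyEta a b c) ^ 2 -
            ((c - b) * (b - a) / ((c - a) * b ^ 2)) ^ 2 * W ^ 2 / L ^ 2| ≤ C' / L ^ 3 ∧
        |crossRatio ![W, g (L * a), g (L * b), g (L * c)] - cardyEta a b c| ≤ C' / L

/-- **Germ moments of a kernel `f`** (the real-variable interface to the analysis half).  Three germ
statistics `mW = E W`, `vW = E W² ≥ 0`, `hK = E hcap > 0`, fixed before the marks, such that for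
all marks `0 < a < b < c` and all large `L` there is a probability law `ν` on `[-C/L, C/L]` with the
EXACT mean-value identity `∫ f(η̂ + x) dν = f(η̂)` at `η̂ = cardyEta a b c` and the moment expansions
`∫ x dν = -S₁ mW / L + (S₁ (a⁻¹+b⁻¹+c⁻¹) hK - (S₁/b) vW) / L² + O(L⁻³)`, `∫ x² dν = S₁² vW / L² + O(L⁻³)`.
[cite: LawlerSchrammWerner2001, §3] [cite: Smirnov2001, Thm 2] -/
def GermMoments (f : ℝ → ℝ) : Prop :=
  ∃ mW vW hK : ℝ, 0 ≤ vW ∧ 0 < hK ∧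
    ∀ a b c : ℝ, 0 < a → a < b → b < c → ∃ L₀ C : ℝ, 0 < L₀ ∧ ∀ L : ℝ, L₀ ≤ L →
      ∃ ν : Measure ℝ, IsProbabilityMeasure ν ∧ ν (Icc (-(C / L)) (C / L))ᶜ = 0 ∧
        ∫ x, f (cardyEta a b c + x) ∂ν = f (cardyEta a b c) ∧
        |∫ x, x ∂ν + (c - b) * (b - a) / ((c - a) * b ^ 2) * mW / L -
            ((c - b) * (b - a) / ((c - a) * b ^ 2) * (a⁻¹ + b⁻¹ + c⁻¹) * hK -
              (c - b) * (b - a) / ((c - a) * b ^ 2) / b * vW) / L ^ 2| ≤ C / L ^ 3 ∧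
        |∫ x, x ^ 2 ∂ν - ((c - b) * (b - a) / ((c - a) * b ^ 2)) ^ 2 * vW / L ^ 2| ≤ C / L ^ 3

/-- **Asymptotic mean-value data** of `f`: verbatim the hypotheses `(m, v, hv, hdata)` of the landed
rigidity theorem `Mvp.affineCardy_of_mvpData` (Theorems/…MvpRigidity).  [cite: Smirnov2001, Thm 2] -/
def MvpData (f : ℝ → ℝ) : Prop :=
  ∃ m v : ℝ, 0 ≤ v ∧
    ∀ a b c : ℝ, 0 < a → a < b → b < c →
      ∃ (r : ℕ → ℝ) (ν : ℕ → Measure ℝ) (L₁ L₂ M₁ : ℝ),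
        Tendsto r atTop (𝓝 0) ∧
        (∀ᶠ n in atTop, IsProbabilityMeasure (ν n) ∧ ν n (Icc (-(r n)) (r n))ᶜ = 0 ∧
          ∫ x, f (cardyEta a b c + x) ∂(ν n) = f (cardyEta a b c)) ∧
        Tendsto (fun n : ℕ ↦ (n : ℝ) * ∫ x, x ∂(ν n)) atTop (𝓝 L₁) ∧
        Tendsto (fun n : ℕ ↦ (n : ℝ) ^ 2 * ∫ x, x ^ 2 ∂(ν n)) atTop (𝓝 L₂) ∧
        (m = 0 → Tendsto (fun n : ℕ ↦ (n : ℝ) ^ 2 * ∫ x, x ∂(ν n)) atTop (𝓝 M₁)) ∧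
        L₁ = -((c - b) * (b - a) / ((c - a) * b ^ 2)) * m ∧
        L₂ = ((c - b) * (b - a) / ((c - a) * b ^ 2)) ^ 2 * v ∧
        M₁ = 2 * (a⁻¹ + b⁻¹ + c⁻¹) * ((c - b) * (b - a) / ((c - a) * b ^ 2)) +
          v / 2 * (-2 * ((c - b) * (b - a)) / ((c - a) * b ^ 3))

/-! ### §1 Registered stubs -/

/-- **STUB G1 (the heart, percolation): the germ catalogue.**  Intended proof: reference Jordan
domain with a straight boundary segment around `p₀`, its certified `ℤ²` discretisation family;
exploration of the interface from `p₀` (fictitious wired layers outside the two arcs at `p₀`) stopped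
at the first exit of the unit ball — its law does not see the far marks; exact domain-Markov /
event identity (cf. `EventIdentity.*`, landed); catalogue = filled `w`-pixel neighbourhoods of the
germ, slightly rounded (Jordan), tip mark on the outer pixel boundary; hydrodynamic data through the
fixed uniformizing map and the mapping-out function of the image hull (`⊂ closedBall 0 2`);
comparison of the slit crossing with the catalogue crossing: discrepancy ⊆ six-arm events at scales
`(w, r)` near the germ frontier ∪ half-plane three-arm events at the flat boundary ∪ fresh crossings
landing within `r` of the tip (`slitNear_measureReal_slitReach_near_le`, landed) — `α₆ > 2`,
`α₃⁺ = 2` give `O(r⁻⁴ w^{α₆-2}) + O(w/r²) + (r)^α → 0`; hcap floor by RSW (exit through the top of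
the ball with probability `≥ p₀`).  Why it might fail: the un-wired `discreteCrossing` recipe
(`meshDomain`, `discreteArc`) must match the exploration's banks up to negligible events.
[cite: CamiaNewman2007, Lemma 7.1–7.4] [cite: Nolin2008, Thm 22–24] [cite: Smirnov2001, §2] -/
theorem stub_germCatalogue : GermCatalogue := by
  sorry

/-- **STUB G2 (deterministic): the germ expansion of the modulus.** Two-variable Taylor expansion
of `cardyEta` along the common shift `-W/L` and the capacity drift `h/(L² y)`, with the landed
`farField_abs_cardyEta_sub_remainder_le` and `farField_hasDerivAt_cardyEta_drift` as first-order
inputs.  Why it might fail: only a sign / coefficient slip (the target coefficients are those of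
`Mvp.affineCardy_of_mvpData`).  [cite: LawlerSchrammWerner2001, §3] -/
theorem stub_etaExpansion : EtaExpansion := by
  sorry

/-- **STUB G3 (limits): germ moments of an all-rectangle kernel.**  From the catalogue at
resolution `ε = 1/k`: HYP on `R₀ L a b c` (datum `(0, La, Lb, Lc)`, modulus `cardyEta a b c` by
`crossRatio_eq_cardyEta` + `cardyEta_mul`) and on the `N` rectangles `Rc j L a b c`; a sequence
`δᵢ → 0⁺` along which the cell weights converge (simplex compact); the comparison passes to
`|f η̂ - ∑ πⱼ f(η_{L,j})| ≤ 1/k`; `ν⁽ᵏ⁾ = ∑ πⱼ δ_{η_{L,j} - η̂}` has the moment expansions of STUB G2 with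
the catalogue statistics `(∑ πⱼ Wⱼ, ∑ πⱼ hⱼ ≥ h₀, ∑ πⱼ Wⱼ²)`, which converge along ONE subsequence
`kᵢ` chosen before the marks; for each `(a,b,c,L)` a further weak limit on the compact interval
gives `ν` with the EXACT identity (`f` continuous near `η̂ ∈ (0,1)`).  Why it might fail: routine
but long (Portmanteau on a compact interval, closedness of the support and moment bounds).
[cite: Smirnov2001, Thm 2] [cite: CamiaNewman2007, Thm 3] -/
theorem stub_germMoments : EtaExpansion → GermCatalogue →
    ∀ f : ℝ → ℝ, AllRectangleKernel f → ContinuousOn f (Ioo 0 1) → GermMoments f := by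
  sorry

/-- **STUB G4 (bookkeeping): mean-value data from germ moments.**  With `s = √(2 / hK)`,
`m = s·mW`, `v = s²·vW`, marks at scale `L_n = n / s` and `r n = C s / n`:
`n ∫ x dν_n → -S₁ m`, `n² ∫ x² dν_n → S₁² v`, and for `m = 0`,
`n² ∫ x dν_n → 2 S₁ (a⁻¹+b⁻¹+c⁻¹) - (S₁/b) v = M₁`.  Why it might fail: it should not (pure limits).
[cite: LawlerSchrammWerner2001, §3] -/
theorem stub_mvpReadout : ∀ f : ℝ → ℝ, GermMoments f → MvpData f := by
  sorry

/-! ### §2 Composition: the stubs imply the crux BY NAME -/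

/-- **The skeleton theorem.**  STUBS G1–G4, the landed kernel facts `stub_kernelFacts` and the
landed rigidity theorem `Mvp.affineCardy_of_mvpData` imply `CardyRigidity`
(stmt-CriticalPhenomena-0746).  [cite: Smirnov2001, Thm 2] [cite: CamiaNewman2007, Thm 3] -/
theorem CardyRigidity_of (hG1 : type_of% @stub_germCatalogue) (hG2 : type_of% @stub_etaExpansion)
    (hG3 : type_of% @stub_germMoments) (hG4 : type_of% @stub_mvpReadout) :
    Summit.CriticalPhenomena.CardyFormulaZ2.Theses.CardyUniqueLimit.CardyRigidity := by
  intro f hf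
  -- landed STUB D of the live line: kernel facts (continuity on (0,1), boundary values 0 and 1)
  obtain ⟨hcont, hf0, hf1⟩ := stub_kernelFacts f hf
  -- G1–G3: germ moments of `f`; G4: the asymptotic mean-value data
  have hmom : GermMoments f := hG3 hG2 hG1 f hf hcont
  obtain ⟨m, v, hv, hdata⟩ := hG4 f hmom
  -- landed analysis: `f = A·I_{2/3} + B` on (0,1)
  obtain ⟨A, B, hfab⟩ := Mvp.affineCardy_of_mvpData hcont hv hdata
  -- the boundary values of `f` along the affine form: `B = 0`, `A = 1`
  have hev0 : ∀ᶠ η in 𝓝[>] (0 : ℝ), f η = A * betaLaw (2 / 3) η + B :=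
    Filter.eventually_of_mem (Ioo_mem_nhdsGT zero_lt_one) fun η hη ↦ hfab hη
  have hev1 : ∀ᶠ η in 𝓝[<] (1 : ℝ), f η = A * betaLaw (2 / 3) η + B :=
    Filter.eventually_of_mem (Ioo_mem_nhdsLT zero_lt_one) fun η hη ↦ hfab hη
  have hlim0 : Tendsto f (𝓝[>] 0) (𝓝 (A * 0 + B)) :=
    ((tendsto_betaLaw_two_thirds_zero.const_mul A).add_const B).congr'
      (hev0.mono fun η hη ↦ hη.symm)
  have hlim1 : Tendsto f (𝓝[<] 1) (𝓝 (A * 1 + B)) :=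
    ((tendsto_betaLaw_two_thirds_one.const_mul A).add_const B).congr'
      (hev1.mono fun η hη ↦ hη.symm)
  have hB0 : B = 0 := by
    have := tendsto_nhds_unique hlim0 hf0
    simpa using this
  have hA1 : A = 1 := by
    have := tendsto_nhds_unique hlim1 hf1
    rw [hB0] at this
    simpa using this
  -- conclusion: `f = I_{2/3} = F` on (0,1)
  intro η hη
  have hfη : f η = A * betaLaw (2 / 3) η + B := hfab hη
  rw [hfη, hA1, hB0, one_mul, add_zero, betaLaw_two_thirds]
  exact (cardyFunction_eq_incBeta13_div_holds η (Ioo_subset_Icc_self hη)).symm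

/-- The composition applied to the registered stubs: the crux, conditionally on STUBS G1–G4 (the only
`sorry`s of this file). [folklore] -/
theorem cardyRigidity_of_stubs :
    Summit.CriticalPhenomena.CardyFormulaZ2.Theses.CardyUniqueLimit.CardyRigidity :=
  CardyRigidity_of stub_germCatalogue stub_etaExpansion stub_germMoments stub_mvpReadout

end Summit.CriticalPhenomena.CardyFormulaZ2.Cruxes.CardyRigidity.ExitHullFarField.GermCatalogueSplit

end
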